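import Summits.Schanuel.Schanuel.Theorems.ZilberEacTranscendenceDensityPole
import HarnessLib

/-!
# Arbitrary base branches, XLVI: THEOREM T with a pole in BOTH relations — `x = U(μ)μ^{-k}`,
# `y = w(μ)μ^{-d}`

HONEST FRAMING.  Cell `pub-schanuel` (Zilber's Exponential-Algebraic Closedness, case ladder;
host summit Schanuel), seat 2, gen 29.  Gen 26's THEOREM T along a ramified parametrisation
(`unprojectedDense_of_transcendental_relation_pole`) takes `y_{j₁} = w(μ)` ANALYTIC in the
parameter.  For pole fibres over conics (`y₀ = R(x₀)`, so `y₁ = R(x₀)e^{p₁/2}e^{η(1/x₀)}` has a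
pole of order `deg R` in `μ = 1/x₀`) the `y`-relation has a pole too.  This file is the verbatim
extension: **`unprojectedDense_of_transcendental_relation_pole₂`** — points `p_m ∈ S ∩ Γ_exp` with
`x_{j₀} = U(μ_m)μ_m^{-k}`, `y_{j₁} = w(μ_m)μ_m^{-d}`, `‖x_{j₀}‖ → ∞`, `μ_m → 0`, `μ_m ≠ 0`, and no
nonzero `H` with `H(U(μ)μ^{-k}, w(μ)μ^{-d}) = 0` for all small `μ ≠ 0` ⟹ `UnprojectedDense S`
(identity principle for `μ ↦ μ^{kN + dD}H(…)`).  [folklore]; nothing here is specific to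
Schanuel's conjecture (neither used nor implied); Mantova–Masser's question (PLMS 2024 §1 p. 5)
stays OPEN; EC(3,2) OPEN.
-/

noncomputable section

open Filter Topology Polynomial MvPolynomial Bornology
open Literature.NumberTheory.Transcendental Literature.ModelTheory.Zilber
open Literature.ModelTheory.ExponentialFields

set_option linter.dupNamespace false

namespace Summit.Schanuel.Schanuel.Theorems

variable {n : ℕ}

/-! ## Part A. The identity principle -/

/-- **Identity principle (two poles).**  `U, w` analytic at `0`, `H ∈ ℂ[s][t]`, and
`H(U(μ_j)μ_j^{-k}, w(μ_j)μ_j^{-d}) = 0` along `μ_j → 0`, `μ_j ≠ 0` ⟹ the same for all small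
`μ ≠ 0`. [folklore] -/
theorem eventually_evalPP_pole₂_eq_zero {U w : ℂ → ℂ} (hU : AnalyticAt ℂ U 0) (hw : AnalyticAt ℂ w 0)
    (k d : ℕ) (H : ℂ[X][X]) {μ : ℕ → ℂ} (hμ0 : ∀ j, μ j ≠ 0) (hμ : Tendsto μ atTop (𝓝 0))
    (hH : ∀ j, (H.map (Polynomial.evalRingHom (U (μ j) * (μ j)⁻¹ ^ k))).eval
      (w (μ j) * (μ j)⁻¹ ^ d) = 0) :
    ∀ᶠ u in 𝓝[≠] (0 : ℂ),
      (H.map (Polynomial.evalRingHom (U u * u⁻¹ ^ k))).eval (w u * u⁻¹ ^ d) = 0 := by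
  classical
  set N : ℕ := (Finset.range (H.natDegree + 1)).sup fun j => (H.coeff j).natDegree with hN
  have hNj : ∀ j ∈ Finset.range (H.natDegree + 1), (H.coeff j).natDegree ≤ N := fun j hj =>
    Finset.le_sup (f := fun j => (H.coeff j).natDegree) hj
  set D : ℕ := H.natDegree with hD
  -- `h(u) = u^{kN + dD} H(U(u)u^{-k}, w(u)u^{-d})`
  set h : ℂ → ℂ := fun u => ∑ j ∈ Finset.range (D + 1),
    (∑ i ∈ Finset.range (N + 1), (H.coeff j).coeff i * U u ^ i * u ^ (k * (N - i))) *
      (w u ^ j * u ^ (d * (D - j))) with hh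
  have hhan : AnalyticAt ℂ h 0 := by
    refine Finset.analyticAt_fun_sum _ fun j _ => AnalyticAt.mul ?_ ((hw.pow j).mul (analyticAt_id.pow _))
    exact Finset.analyticAt_fun_sum _ fun i _ =>
      (analyticAt_const.mul (hU.pow i)).mul (analyticAt_id.pow _)
  have hh_eq : ∀ u : ℂ, u ≠ 0 →
      h u = u ^ (k * N) * u ^ (d * D) *
        (H.map (Polynomial.evalRingHom (U u * u⁻¹ ^ k))).eval (w u * u⁻¹ ^ d) := by
    intro u hu
    rw [hh, evalPP_eq_sum H _ (w u * u⁻¹ ^ d) (Nat.lt_succ_self _), Finset.mul_sum]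
    refine Finset.sum_congr rfl fun j hj => ?_
    have hjD : j ≤ D := Nat.lt_succ_iff.1 (Finset.mem_range.1 hj)
    rw [← pow_mul_eval_mul_inv_pow_eq_sum _ (hNj j hj) k (U u) hu]
    have e : u ^ (d * D) * (w u * u⁻¹ ^ d) ^ j = w u ^ j * u ^ (d * (D - j)) := by
      rw [mul_pow, ← pow_mul, inv_pow, Nat.mul_sub, pow_sub₀ _ hu (Nat.mul_le_mul_left d hjD),
        mul_comm d j]
      field_simp
    calc u ^ (k * N) * (H.coeff j).eval (U u * u⁻¹ ^ k) * (w u ^ j * u ^ (d * (D - j)))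
        = u ^ (k * N) * (H.coeff j).eval (U u * u⁻¹ ^ k) * (u ^ (d * D) * (w u * u⁻¹ ^ d) ^ j) := by
          rw [e]
      _ = u ^ (k * N) * u ^ (d * D) *
          ((Polynomial.evalRingHom (U u * u⁻¹ ^ k)) (H.coeff j) * (w u * u⁻¹ ^ d) ^ j) := by
          rw [Polynomial.coe_evalRingHom]; ring
  have hμ' : Tendsto μ atTop (𝓝[≠] (0 : ℂ)) :=
    tendsto_nhdsWithin_iff.2 ⟨hμ, Eventually.of_forall fun j => hμ0 j⟩
  have hzero : ∀ j, h (μ j) = 0 := fun j => by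
    rw [hh_eq _ (hμ0 j), hH j, mul_zero]
  rcases hhan.eventually_eq_zero_or_eventually_ne_zero with h0 | hne
  · have h0' : ∀ᶠ u in 𝓝[≠] (0 : ℂ), h u = 0 ∧ u ≠ 0 :=
      (h0.filter_mono nhdsWithin_le_nhds).and self_mem_nhdsWithin
    filter_upwards [h0'] with u hu'
    have h1 := hu'.1
    rw [hh_eq u hu'.2] at h1
    exact (mul_eq_zero.1 h1).resolve_left
      (mul_ne_zero (pow_ne_zero _ hu'.2) (pow_ne_zero _ hu'.2))
  · exfalso
    obtain ⟨j, hj⟩ := (hμ'.eventually hne).exists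
    exact hj (hzero j)

/-! ## Part B. THEOREM T with two poles -/

/-- **THEOREM T, two poles (finiteness).**  As `finite_zeros_of_transcendental_relation_pole` with
`y_{j₁}(p_m) = w(μ_m)μ_m^{-d}`. [folklore] (new in this form) -/
theorem finite_zeros_of_transcendental_relation_pole₂ {S : Set (Fin n ⊕ Fin n → ℂ)}
    (hS : IsIrreducibleClosed ℂ S) (hdim : zariskiDim ℂ S ≤ (2 : ℕ)) (j₀ j₁ : Fin n)
    {p : ℕ → Fin n ⊕ Fin n → ℂ} (hpS : ∀ m, p m ∈ S)
    (hnorm : Tendsto (fun m => ‖p m (Sum.inl j₀)‖) atTop atTop)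
    {U w : ℂ → ℂ} (hU : AnalyticAt ℂ U 0) (hw : AnalyticAt ℂ w 0) (k d : ℕ) {μ : ℕ → ℂ}
    (hμ0 : ∀ m, μ m ≠ 0) (hμ : Tendsto μ atTop (𝓝 0))
    (hx : ∀ m, p m (Sum.inl j₀) = U (μ m) * (μ m)⁻¹ ^ k)
    (hy : ∀ m, p m (Sum.inr j₁) = w (μ m) * (μ m)⁻¹ ^ d)
    (htr : ∀ H : ℂ[X][X], H ≠ 0 →
      ¬ (∀ᶠ u in 𝓝[≠] (0 : ℂ),
        (H.map (Polynomial.evalRingHom (U u * u⁻¹ ^ k))).eval (w u * u⁻¹ ^ d) = 0))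
    (f : MvPolynomial (Fin n ⊕ Fin n) ℂ) (hf : f ∉ vanishingIdeal ℂ S) :
    Set.Finite {m | aeval (p m) f = 0} := by
  classical
  by_contra hinf
  change Set.Infinite {m | aeval (p m) f = 0} at hinf
  set x : ℕ → ℂ := fun m => p m (Sum.inl j₀) with hxdef
  obtain ⟨M, hMinf, hMf, hJ⟩ := exists_infinite_isPrime_vanishingIdeal hinf
  set J := vanishingIdeal ℂ (p '' M) with hJdef
  haveI := hJ
  have hIJ : vanishingIdeal ℂ S ≤ J :=
    vanishingIdeal_anti_mono (by rintro _ ⟨m, -, rfl⟩; exact hpS m)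
  have hfJ : f ∈ J := by
    rw [hJdef, mem_vanishingIdeal_iff]
    rintro _ ⟨m, hm, rfl⟩
    exact hMf m hm
  have hdimJ := ringKrullDim_quotient_le_one hS hdim hIJ hfJ hf
  set Q' := MvPolynomial (Fin n ⊕ Fin n) ℂ ⧸ J with hQ'
  haveI : IsDomain Q' := Ideal.Quotient.isDomain _
  have htr1 : Algebra.trdeg ℂ Q' ≤ 1 := by
    have h := Literature.RingTheory.KrullDimension.ringKrullDim_eq_trdeg ℂ Q'
    rw [h] at hdimJ
    have hnat : Cardinal.toNat (Algebra.trdeg ℂ Q') ≤ 1 := by exact_mod_cast hdimJ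
    rw [Literature.RingTheory.KrullDimension.trdeg_eq_toNat ℂ Q']
    exact_mod_cast hnat
  have hxM : ∀ R : ℝ, ∃ m ∈ M, R ≤ ‖x m‖ := by
    intro R
    rcases (tendsto_atTop_atTop.1 hnorm R) with ⟨N', hN'⟩
    obtain ⟨m, hm, hNm⟩ := hMinf.exists_gt N'
    exact ⟨m, hm, hN' m hNm.le⟩
  haveI : FaithfulSMul ℂ Q' := (faithfulSMul_iff_algebraMap_injective ℂ Q').2 (algebraMap ℂ Q').injective
  have hutr := transcendental_mk_X_of_unbounded (p := p) (M := M) j₀ hxM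
  obtain ⟨H, hH0, hHuv⟩ := exists_polyPoly_relation
    (isAlgebraic_adjoin_of_trdeg_le_one htr1 hutr (Ideal.Quotient.mk J (X (Sum.inr j₁))))
  have hHroot : ∀ m ∈ M,
      (H.map (Polynomial.evalRingHom (U (μ m) * (μ m)⁻¹ ^ k))).eval (w (μ m) * (μ m)⁻¹ ^ d) = 0 := by
    intro m hm
    rw [← hx m, ← hy m]
    exact polyPoly_eval_eq_zero_of_mem₂ (Sum.inl j₀) (Sum.inr j₁) hHuv hm
  set φ : ℕ → ℕ := Nat.nth (· ∈ M) with hφ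
  have hφM : ∀ i, φ i ∈ M := fun i => Nat.nth_mem_of_infinite (p := (· ∈ M)) hMinf i
  have hφtop : Tendsto φ atTop atTop := (Nat.nth_strictMono (p := (· ∈ M)) hMinf).tendsto_atTop
  exact htr H hH0 (eventually_evalPP_pole₂_eq_zero hU hw k d H (fun i => hμ0 (φ i)) (hμ.comp hφtop)
    fun i => hHroot _ (hφM i))

/-- **THEOREM T, two poles (density).** [folklore] (new in this form) -/
theorem unprojectedDense_of_transcendental_relation_pole₂ {S : Set (Fin n ⊕ Fin n → ℂ)}
    (hS : IsIrreducibleClosed ℂ S) (hdim : zariskiDim ℂ S ≤ (2 : ℕ)) (j₀ j₁ : Fin n)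
    {p : ℕ → Fin n ⊕ Fin n → ℂ} (hpS : ∀ m, p m ∈ S) (hpΓ : ∀ m, p m ∈ expGraph ℂ n)
    (hnorm : Tendsto (fun m => ‖p m (Sum.inl j₀)‖) atTop atTop)
    {U w : ℂ → ℂ} (hU : AnalyticAt ℂ U 0) (hw : AnalyticAt ℂ w 0) (k d : ℕ) {μ : ℕ → ℂ}
    (hμ0 : ∀ m, μ m ≠ 0) (hμ : Tendsto μ atTop (𝓝 0))
    (hx : ∀ m, p m (Sum.inl j₀) = U (μ m) * (μ m)⁻¹ ^ k)
    (hy : ∀ m, p m (Sum.inr j₁) = w (μ m) * (μ m)⁻¹ ^ d)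
    (htr : ∀ H : ℂ[X][X], H ≠ 0 →
      ¬ (∀ᶠ u in 𝓝[≠] (0 : ℂ),
        (H.map (Polynomial.evalRingHom (U u * u⁻¹ ^ k))).eval (w u * u⁻¹ ^ d) = 0)) :
    UnprojectedDense S := by
  refine le_antisymm ?_ (vanishingIdeal_anti_mono Set.inter_subset_left)
  intro f hf
  by_contra hfS
  have hfin := finite_zeros_of_transcendental_relation_pole₂ hS hdim j₀ j₁ hpS hnorm hU hw k d hμ0 hμ
    hx hy htr f hfS
  have hall : {m | aeval (p m) f = 0} = Set.univ := by
    ext m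
    simp only [Set.mem_setOf_eq, Set.mem_univ, iff_true]
    exact (mem_vanishingIdeal_iff.1 hf) _ ⟨hpS m, hpΓ m⟩
  rw [hall] at hfin
  exact Set.infinite_univ hfin

end Summit.Schanuel.Schanuel.Theorems

end
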